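import Summits.QuantumFields.YangMills.Theorems.UnitScaleTiltProp7NestedMeanParallelLiftParSplit
import Summits.QuantumFields.YangMills.Theorems.UnitScaleTiltProp7SymCentreCentral
import HarnessLib

/-!
# Route `UnitScaleTilt`, crux K1 child «MinimiserStabilityRegPr» (stmt-QuantumFields-19200), stub `stub_existenceMinimalOrbit` (EX), line «SYM-CENTRE»
# (★★OWNER RULING g28-№7 cure (ii-a); px20 g2 LOCATE #56 §6) — **REDUCTION OF THE DISPLAYED ROW `hSymCentre` TO THE DIAGONAL (ABELIAN) STRATUM: a supplier
# of symmetric regular centres for σ₃-DIAGONAL coarse fields ONLY (the content of (R3)∕(R4)) yields `hSymCentre`'s ∃-body for EVERY small-plaquette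
# coarse field with a regular fibre point — and the supplier may even assume a NON-CENTRAL bond value**

Cell `ym3-torus`, width seat `ym3-torus-px6` (gen 3).  THEOREMS ONLY (0 `def`, 0 `sorry`).  `--supports stmt-QuantumFields-19200 --as helper`, count-neutral.
YM₃ on T³ is a ladder rung (R3), not the Clay problem; nothing here claims the stub, the crux, d = 4 or the mass gap.

THE POINT.  The shell of the `hSymCentre` supplier, BY NAME over the landed pieces of the line: the case split ✓`onlyScalar_or_exists_gauge_commute_sigma3`
(✓p674114); the irreducible branch ✓`hSymCentre_of_irreducible` (✓p672476; the GIVEN fibre point serves, radius raised by `regPr_mono`); the diagonal branch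
= the SUPPLIER HYPOTHESIS `hSup` at the re-gauged field `g • V` (small plaquettes are gauge invariant, lit ✓`plaqSmall_gaugeAct_iff'`) transported back to
`V` by ✓`exists_symCentre_of_gaugeAct` (✓p673539); and, in the sharpened form, the central-VALUED diagonal sub-branch ✓`hSymCentre_of_central` (✓p673055) so
that the supplier may assume a non-central bond value (the genuinely abelian configurations of (R4)).
* ★★★`exists_symCentre_of_diagonalSupplier` — `hSup : ∀ V′, (∀ e, Commute ↑(V′ e) σ₃) → PlaqSmall δ V′ → ∃ U₁ ∈ fibre V′, RegPr a′ U₁ ∧ hLift U₁` ⟹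
  for all `V U₀` with `PlaqSmall δ V`, `U₀ ∈ fibre V`, `RegPr a U₀` (`10⁷L³a ≤ 1`, `a ≤ a′`, `b > 0`): `∃ U₁ ∈ fibre V, RegPr a′ U₁ ∧ CloseAvg b V U₁ ∧ hLift U₁`.
* ★★★`exists_symCentre_of_nonCentralDiagonalSupplier` — the same with `hSup` restricted to diagonal `V′` having SOME non-central bond value (`δ ≤ 2`).
HONEST SCOPE.  A composition of landed theorems; the supplier hypothesis IS the open content of the line ((R3) smoothed exact abelian lift ★px19, (R4)
`hSymCentre_of_reducible` ★px20, plus the flux-sector question of #56 §3.1); no estimate; no stub ∕ crux statement is advanced.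

References: T. Bałaban, CMP 102 (1985) 277–309 [Balaban1985Variational] ((2)–(7) p.278, (13)–(14) p.280); CMP 99 (1985) 389–434 [Balaban1985BackgroundPropagators]
((3.19)–(3.21) pp.393–394); CMP 98 (1985) 17–51 [Balaban1985Averaging] ((8)–(13) p.19).
-/

set_option autoImplicit false

noncomputable section

open scoped BigOperators Matrix.Norms.L2Operator Matrix

namespace Summit.QuantumFields.YangMills.Theorems.Prop7NestedMeanParallelLiftDiagGauge

open Literature.MathematicalPhysics.QuantumFieldTheory.Balaban1983to89
open T4Continuum BlockAveraging
open B10Eq27TorusAxialLog (unitsField toUField)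
open B15DeterminingSets (embIter)
open B9AdOrthogonal (σ₃)
open Summit.QuantumFields.YangMills.Theorems.Prop8Chart (emlIterU)
open Literature.MathematicalPhysics.QuantumFieldTheory.Balaban1983to89.T3ContinuumYM3Torus
open T3UnitLawDensityEML (ℰp)
open T3ConstrainedMinimiser (fibre)
open T3PrintedRegularMinimiser (RegPr)
open T3PrintedMinimiserExistence (regPr_mono)
open T3PrintedRegularOrbits (plaqSmall_gaugeAct_iff')
open T3SectALandauChart (bgUnits CloseAvg closeAvg_of_mem_fibre)
open Summit.QuantumFields.YangMills.Theorems.Prop7NestedMeanParallelLift (hSymCentre_of_irreducible)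
open Summit.QuantumFields.YangMills.Theorems.Prop7SymCentreCentral (hSymCentre_of_central)

section T3

variable (F : T3Family) {n K : ℕ}

/-- ★★★ **`hSymCentre` FROM A DIAGONAL-ONLY SUPPLIER.**  Suppose that for every σ₃-DIAGONAL coarse field `V′` (every bond variable commutes with `σ₃`) with
`PlaqSmall δ V′` a fibre point `U₁` with `RegPr a′ U₁` and `hLift U₁` is supplied.  Then for every coarse `V` with `PlaqSmall δ V` and every regular fibre point
`U₀ ∈ fibre V`, `RegPr a U₀` (`10⁷L³a ≤ 1`, `a ≤ a′`), there is `U₁ ∈ fibre V` with `RegPr a′ U₁`, `CloseAvg b V U₁` (any `b > 0`) and `hLift U₁` — irreducible `V`: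
`U₁ := U₀`; reducible `V`: re-gauge to diagonal, supply, undo the gauge. [cite: Balaban1985Variational, (2)-(7) p.278, (13)-(14) p.280; Balaban1985BackgroundPropagators, (3.21) p.394] -/
theorem exists_symCentre_of_diagonalSupplier (h : n ≤ K) {δ a a' b : ℝ} (ha : 0 < a) (haW : 10 ^ 7 * (F.L : ℝ) ^ 3 * a ≤ 1) (haa' : a ≤ a') (hb : 0 < b)
    (hSup : ∀ V' : GaugeField (F.P n) 0 (Matrix.specialUnitaryGroup (Fin 2) ℂ),
      (∀ e : PBond (F.P n) 0, Commute ((V' e : Matrix.specialUnitaryGroup (Fin 2) ℂ) : Matrix (Fin 2) (Fin 2) ℂ) σ₃) → PlaqSmall δ V' →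
      ∃ U₁ : GaugeField (F.P K) 0 (Matrix.specialUnitaryGroup (Fin 2) ℂ), U₁ ∈ fibre F ℰp n K h V' ∧ RegPr F n K a' U₁ ∧
        ∀ cf : Site (F.P K) (K - n) → Matrix (Fin 2) (Fin 2) ℂ,
          (∀ e : PBond (F.P K) (K - n), cf e.src = ((emlIterU (K - n) (bgUnits F K U₁) e : (Matrix (Fin 2) (Fin 2) ℂ)ˣ) : Matrix (Fin 2) (Fin 2) ℂ) * cf e.tgt *
            (((emlIterU (K - n) (bgUnits F K U₁) e)⁻¹ : (Matrix (Fin 2) (Fin 2) ℂ)ˣ) : Matrix (Fin 2) (Fin 2) ℂ)) →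
          ∃ l₀ : Site (F.P K) 0 → Matrix (Fin 2) (Fin 2) ℂ,
            (∀ b' : PBond (F.P K) 0, l₀ b'.src = ((bgUnits F K U₁ b' : (Matrix (Fin 2) (Fin 2) ℂ)ˣ) : Matrix (Fin 2) (Fin 2) ℂ) * l₀ b'.tgt * (((bgUnits F K U₁ b')⁻¹ : (Matrix (Fin 2) (Fin 2) ℂ)ˣ) : Matrix (Fin 2) (Fin 2) ℂ)) ∧
            ∀ y : Site (F.P K) (K - n), l₀ (embIter (K - n) y) = cf y)
    {V : GaugeField (F.P n) 0 (Matrix.specialUnitaryGroup (Fin 2) ℂ)} {U₀ : GaugeField (F.P K) 0 (Matrix.specialUnitaryGroup (Fin 2) ℂ)}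
    (hV : PlaqSmall δ V) (hfib : U₀ ∈ fibre F ℰp n K h V) (hreg : RegPr F n K a U₀) :
    ∃ U₁ : GaugeField (F.P K) 0 (Matrix.specialUnitaryGroup (Fin 2) ℂ),
      U₁ ∈ fibre F ℰp n K h V ∧ RegPr F n K a' U₁ ∧ CloseAvg F n K h b V U₁ ∧
      ∀ cf : Site (F.P K) (K - n) → Matrix (Fin 2) (Fin 2) ℂ,
        (∀ e : PBond (F.P K) (K - n), cf e.src = ((emlIterU (K - n) (bgUnits F K U₁) e : (Matrix (Fin 2) (Fin 2) ℂ)ˣ) : Matrix (Fin 2) (Fin 2) ℂ) * cf e.tgt *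
          (((emlIterU (K - n) (bgUnits F K U₁) e)⁻¹ : (Matrix (Fin 2) (Fin 2) ℂ)ˣ) : Matrix (Fin 2) (Fin 2) ℂ)) →
        ∃ l₀ : Site (F.P K) 0 → Matrix (Fin 2) (Fin 2) ℂ,
          (∀ b' : PBond (F.P K) 0, l₀ b'.src = ((bgUnits F K U₁ b' : (Matrix (Fin 2) (Fin 2) ℂ)ˣ) : Matrix (Fin 2) (Fin 2) ℂ) * l₀ b'.tgt * (((bgUnits F K U₁ b')⁻¹ : (Matrix (Fin 2) (Fin 2) ℂ)ˣ) : Matrix (Fin 2) (Fin 2) ℂ)) ∧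
          ∀ y : Site (F.P K) (K - n), l₀ (embIter (K - n) y) = cf y := by
  rcases onlyScalar_or_exists_gauge_commute_sigma3 V with hIrr | ⟨g, hdiag⟩
  · -- irreducible: the given fibre point serves
    obtain ⟨U₁, hU₁, hregU₁, hclose, hLift⟩ := hSymCentre_of_irreducible F h ha haW hb hfib hreg hIrr
    exact ⟨U₁, hU₁, regPr_mono F haa' hregU₁, hclose, hLift⟩
  · -- reducible: re-gauge to diagonal, supply, undo the gauge
    obtain ⟨U₁, hU₁, hregU₁, hLift⟩ := hSup (GaugeField.gaugeAct g V) hdiag ((plaqSmall_gaugeAct_iff' δ g V).2 hV)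
    exact exists_symCentre_of_gaugeAct F h g (ha.le.trans haa') hb ⟨U₁, hU₁, hregU₁, hLift⟩

/-- ★★★ **`hSymCentre` FROM A SUPPLIER FOR DIAGONAL FIELDS WITH A NON-CENTRAL BOND VALUE** (`δ ≤ 2`): the central-VALUED diagonal fields are served by the iterated
face section (✓`hSymCentre_of_central`, every radius), so the supplier hypothesis may additionally assume `∃ e, ¬ ∀ M, Commute ↑(V′ e) M` — the genuinely
abelian configurations. [cite: Balaban1985Variational, (2)-(7) p.278, (13)-(14) p.280; Balaban1987RG1, (0.11) p.253] -/
theorem exists_symCentre_of_nonCentralDiagonalSupplier (h : n ≤ K) {δ a a' b : ℝ} (hδ : δ ≤ 2) (ha : 0 < a) (haW : 10 ^ 7 * (F.L : ℝ) ^ 3 * a ≤ 1)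
    (haa' : a ≤ a') (hb : 0 < b)
    (hSup : ∀ V' : GaugeField (F.P n) 0 (Matrix.specialUnitaryGroup (Fin 2) ℂ),
      (∀ e : PBond (F.P n) 0, Commute ((V' e : Matrix.specialUnitaryGroup (Fin 2) ℂ) : Matrix (Fin 2) (Fin 2) ℂ) σ₃) →
      (∃ e : PBond (F.P n) 0, ¬ ∀ M : Matrix (Fin 2) (Fin 2) ℂ, Commute ((V' e : Matrix.specialUnitaryGroup (Fin 2) ℂ) : Matrix (Fin 2) (Fin 2) ℂ) M) →
      PlaqSmall δ V' →
      ∃ U₁ : GaugeField (F.P K) 0 (Matrix.specialUnitaryGroup (Fin 2) ℂ), U₁ ∈ fibre F ℰp n K h V' ∧ RegPr F n K a' U₁ ∧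
        ∀ cf : Site (F.P K) (K - n) → Matrix (Fin 2) (Fin 2) ℂ,
          (∀ e : PBond (F.P K) (K - n), cf e.src = ((emlIterU (K - n) (bgUnits F K U₁) e : (Matrix (Fin 2) (Fin 2) ℂ)ˣ) : Matrix (Fin 2) (Fin 2) ℂ) * cf e.tgt *
            (((emlIterU (K - n) (bgUnits F K U₁) e)⁻¹ : (Matrix (Fin 2) (Fin 2) ℂ)ˣ) : Matrix (Fin 2) (Fin 2) ℂ)) →
          ∃ l₀ : Site (F.P K) 0 → Matrix (Fin 2) (Fin 2) ℂ,
            (∀ b' : PBond (F.P K) 0, l₀ b'.src = ((bgUnits F K U₁ b' : (Matrix (Fin 2) (Fin 2) ℂ)ˣ) : Matrix (Fin 2) (Fin 2) ℂ) * l₀ b'.tgt * (((bgUnits F K U₁ b')⁻¹ : (Matrix (Fin 2) (Fin 2) ℂ)ˣ) : Matrix (Fin 2) (Fin 2) ℂ)) ∧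
            ∀ y : Site (F.P K) (K - n), l₀ (embIter (K - n) y) = cf y)
    {V : GaugeField (F.P n) 0 (Matrix.specialUnitaryGroup (Fin 2) ℂ)} {U₀ : GaugeField (F.P K) 0 (Matrix.specialUnitaryGroup (Fin 2) ℂ)}
    (hV : PlaqSmall δ V) (hfib : U₀ ∈ fibre F ℰp n K h V) (hreg : RegPr F n K a U₀) :
    ∃ U₁ : GaugeField (F.P K) 0 (Matrix.specialUnitaryGroup (Fin 2) ℂ),
      U₁ ∈ fibre F ℰp n K h V ∧ RegPr F n K a' U₁ ∧ CloseAvg F n K h b V U₁ ∧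
      ∀ cf : Site (F.P K) (K - n) → Matrix (Fin 2) (Fin 2) ℂ,
        (∀ e : PBond (F.P K) (K - n), cf e.src = ((emlIterU (K - n) (bgUnits F K U₁) e : (Matrix (Fin 2) (Fin 2) ℂ)ˣ) : Matrix (Fin 2) (Fin 2) ℂ) * cf e.tgt *
          (((emlIterU (K - n) (bgUnits F K U₁) e)⁻¹ : (Matrix (Fin 2) (Fin 2) ℂ)ˣ) : Matrix (Fin 2) (Fin 2) ℂ)) →
        ∃ l₀ : Site (F.P K) 0 → Matrix (Fin 2) (Fin 2) ℂ,
          (∀ b' : PBond (F.P K) 0, l₀ b'.src = ((bgUnits F K U₁ b' : (Matrix (Fin 2) (Fin 2) ℂ)ˣ) : Matrix (Fin 2) (Fin 2) ℂ) * l₀ b'.tgt * (((bgUnits F K U₁ b')⁻¹ : (Matrix (Fin 2) (Fin 2) ℂ)ˣ) : Matrix (Fin 2) (Fin 2) ℂ)) ∧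
          ∀ y : Site (F.P K) (K - n), l₀ (embIter (K - n) y) = cf y := by
  refine exists_symCentre_of_diagonalSupplier F h ha haW haa' hb (fun V' hdiag hV' => ?_) hV hfib hreg
  by_cases hcen : ∀ (e : PBond (F.P n) 0) (M : Matrix (Fin 2) (Fin 2) ℂ), Commute ((V' e : Matrix.specialUnitaryGroup (Fin 2) ℂ) : Matrix (Fin 2) (Fin 2) ℂ) M
  · -- central values: the iterated face section, at radius `a′`
    obtain ⟨hfib₁, hreg₁, -, hLift₁⟩ := hSymCentre_of_central F h V' hcen hδ hV' (ha.trans_le haa') hb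
    exact ⟨_, hfib₁, hreg₁, hLift₁⟩
  · -- a non-central bond value: the supplier
    have hnc : ∃ e : PBond (F.P n) 0, ¬ ∀ M : Matrix (Fin 2) (Fin 2) ℂ, Commute ((V' e : Matrix.specialUnitaryGroup (Fin 2) ℂ) : Matrix (Fin 2) (Fin 2) ℂ) M := by
      by_contra hne
      exact hcen fun e M => by
        by_contra hM
        exact hne ⟨e, fun hall => hM (hall M)⟩
    exact hSup V' hdiag hnc hV'

end T3

end Summit.QuantumFields.YangMills.Theorems.Prop7NestedMeanParallelLiftDiagGauge

end
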